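import Summits.ABC.ABC.Theorems.TwistAmplificationSharpModerateLawFewDeepBudget
import Mathlib.NumberTheory.Harmonic.Bounds

/-!
# Crux `TwistAmplification.SharpModerateLaw` (stmt-ABC-1975), line `syzygy-lattice-half-deep-few-primes`:
few-deep assembly II — the slice map and the per-key bound

Support file (`--supports stmt-ABC-1975`) of the stub `stub_fewDeepOfLattice : FewDeepOfLattice`,
continuing `TwistAmplificationSharpModerateLawFewDeepBudget.lean` (namespace `…SharpModerateLaw.FewDeepSlice`,
no new definitions; `g = gcd(q)`, `q₀ = q/g`, `ρ`, `a`, `t` as there):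
* `prim_mem_lhSet`: for `q` few-deep in `ifShell F X Y` (`D ≠ 0`), `q₀` satisfies the seven conditions of
  the primitive set counted by `LatticeHalf` with forced divisor `t`, level `Y/g⁶`, radical budget
  `6·a·t·X/ρ²` and depth cap `X·Y^{-1/6}/(g·rad D)`, and `Mplus F q₀ ≥ 256` (so the level is `> 128`);
* `key_facts`: `1 ≤ g ≤ ⌈2Y⌉`, `t ∣ g`, `g ≤ 216·ρ`, `a ∣ gcd(g, rad D)`, `rad D · t ∣ rad(D·t)`;
* `key_bound`: Kane's bound at these parameters is at most
  `C (486 X Y⁵)^δ · 279937 · X Y^{-1/6} · gcd(g, rad D)/(g · rad D)` (pure arithmetic);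
* `sum_gcd_div_le` (exported as the registered `fewDeepSlices_main`): `Σ_{g ≤ N} gcd(g, R)/g ≤ τ(R) · H_N`;
  `harmonic_le_rpow`: `H_N ≤ (1 + 1/δ) N^δ`.
-/

noncomputable section

namespace Summit.ABC.ABC.Theorems.SharpModerateLaw

namespace FewDeepSlice

open Literature.NumberTheory.CubicFields
open UniqueFactorizationMonoid (radical radical_dvd_self radical_dvd_radical)
open scoped BigOperators

/-! ## 3. The slice map `q ↦ q₀ = q/g` into Kane's primitive sets -/

/-- `(Y/g⁶)^{-1/6} = g · Y^{-1/6}`. -/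
theorem level_rpow {Y g : ℝ} (hY : 0 < Y) (hg : 0 < g) :
    (Y / g ^ 6) ^ (-(1 / 6 : ℝ)) = g * Y ^ (-(1 / 6 : ℝ)) := by
  have h6 : (g ^ 6) ^ (1 / 6 : ℝ) = g := by
    rw [← Real.rpow_natCast, ← Real.rpow_mul hg.le]; norm_num
  rw [Real.rpow_neg (by positivity), Real.rpow_neg hY.le, Real.div_rpow hY.le (by positivity), h6,
    inv_div, div_eq_mul_inv]

/-- **The slice map.** For `q` few-deep in the shell of `F` (`D ≠ 0`), `q₀ = q/g` satisfies the seven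
conditions of Kane's primitive set (verbatim the set counted by `LatticeHalf`) with forced divisor `t`,
level `Y/g⁶`, radical budget `6·a·t·X/ρ²` and depth cap `X·Y^{-1/6}/(g·rad D)`; and `Mplus F q₀ ≥ 256`. -/
theorem prim_mem_lhSet {F : BinaryCubic ℤ} (hD : F.disc ≠ 0) {X Y : ℝ} {q : ℤ × ℤ}
    (hq : q ∈ ifShell F X Y) (hfd : FewDeep X Y F q) {q₀ : ℤ × ℤ}
    (hq₀ : q₀ = (q.1 / (Int.gcd q.1 q.2 : ℤ), q.2 / (Int.gcd q.1 q.2 : ℤ))) {a t ρ : ℕ}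
    (ha : a = ∏ p ∈ (Int.gcd q.1 q.2).primeFactors with 5 ≤ p ∧ p ∣ F.disc.natAbs, p)
    (ht : t = ∏ p ∈ (Int.gcd q.1 q.2).primeFactors with
      (5 ≤ p ∧ ¬ p ∣ F.disc.natAbs) ∧ p ∣ (F.eval q₀.1 q₀.2).natAbs, p)
    (hρ : ρ = ∏ p ∈ (Int.gcd q.1 q.2).primeFactors with 5 ≤ p, p) :
    (Int.gcd q₀.1 q₀.2 = 1 ∧ Y / (Int.gcd q.1 q.2 : ℝ) ^ 6 ≤ (Mplus F q₀ : ℝ) ∧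
      (Mplus F q₀ : ℝ) < 2 * (Y / (Int.gcd q.1 q.2 : ℝ) ^ 6) ∧ F.eval q₀.1 q₀.2 ≠ 0 ∧
      (t : ℤ) ∣ F.disc * F.eval q₀.1 q₀.2 ∧
      ((radical (F.disc * F.eval q₀.1 q₀.2).natAbs : ℕ) : ℝ) ≤ 6 * a * t * X / (ρ : ℝ) ^ 2 ∧
      ((depthRad (F.eval q₀.1 q₀.2).natAbs : ℕ) : ℝ) ≤
        X * Y ^ (-(1 / 6 : ℝ)) / ((Int.gcd q.1 q.2 : ℝ) * radical F.disc.natAbs)) ∧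
    256 ≤ Mplus F q₀ := by
  obtain ⟨hF, hH, -, -, hY1, hY2, hN⟩ := hq
  set g := Int.gcd q.1 q.2 with hg_def
  have hg0 : 0 < g := Int.gcd_pos_iff.mpr (by
    by_contra h; push Not at h; apply hF; rw [h.1, h.2]; simp [BinaryCubic.eval])
  have e : ((g : ℤ) * q₀.1, (g : ℤ) * q₀.2) = q := by rw [hq₀]; exact smul_ediv_gcd q
  have e1 : (g : ℤ) * q₀.1 = q.1 := congrArg Prod.fst e
  have e2 : (g : ℤ) * q₀.2 = q.2 := congrArg Prod.snd e
  have hF0 : F.eval q.1 q.2 = (g : ℤ) ^ 3 * F.eval q₀.1 q₀.2 := by rw [← e1, ← e2, eval_smul']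
  have hH0 : hessAt F q.1 q.2 = (g : ℤ) ^ 2 * hessAt F q₀.1 q₀.2 := by rw [← e1, ← e2, hessAt_smul']
  have hM : Mplus F q = g ^ 6 * Mplus F q₀ := by rw [← mplus_smul, e]
  have hF₀ : F.eval q₀.1 q₀.2 ≠ 0 := fun h => hF (by rw [hF0, h, mul_zero])
  have hH₀ : hessAt F q₀.1 q₀.2 ≠ 0 := fun h => hH (by rw [hH0, h, mul_zero])
  have hg6 : (0 : ℝ) < (g : ℝ) ^ 6 := by positivity
  have hMr : (Mplus F q : ℝ) = (g : ℝ) ^ 6 * Mplus F q₀ := by rw [hM]; push_cast; ring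
  have h256 : 256 ≤ Mplus F q₀ :=
    le_max_of_le_right (Nat.le_mul_of_pos_right 256 (pow_pos (Int.natAbs_pos.mpr hH₀) 3))
  refine ⟨⟨?_, ?_, ?_, hF₀, ?_, radical_le_budget hD hg0.ne' hF₀ (by rwa [e]) ha ht hρ, ?_⟩, h256⟩
  · rw [hq₀]; exact Int.gcd_div_gcd_div_gcd hg0
  · rw [div_le_iff₀ hg6]; nlinarith
  · rw [mul_div_assoc', lt_div_iff₀ hg6]; nlinarith
  · have : t ∣ (F.eval q₀.1 q₀.2).natAbs := ht ▸ prod_primeFactors_filter_dvd fun p _ hP => hP.2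
    exact (Int.natCast_dvd.mpr this).mul_left _
  · have hfd' : (g : ℝ) * radical F.disc.natAbs * (depthRad (F.eval q₀.1 q₀.2).natAbs : ℕ) ≤
        X * Y ^ (-(1 / 6 : ℝ)) := by rw [hq₀]; exact hfd
    have hpos : (0 : ℝ) < (g : ℝ) * radical F.disc.natAbs := by
      have := Nat.radical_pos F.disc.natAbs; positivity
    rw [le_div_iff₀ hpos]; linarith

/-- Bookkeeping of the key `(g, t)` of a shell point (`t` a forced divisor, `ρ`, `a` as in §2):
`1 ≤ g ≤ ⌈2Y⌉`, `t ∣ g`, `g ≤ 216·ρ`, `a ∣ gcd(g, rad D)`, `rad D · t ∣ rad(D·t)`. -/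
theorem key_facts {F : BinaryCubic ℤ} (hD : F.disc ≠ 0) {X Y : ℝ} {q : ℤ × ℤ}
    (hq : q ∈ ifShell F X Y) {m a t ρ : ℕ}
    (ha : a = ∏ p ∈ (Int.gcd q.1 q.2).primeFactors with 5 ≤ p ∧ p ∣ F.disc.natAbs, p)
    (ht : t = ∏ p ∈ (Int.gcd q.1 q.2).primeFactors with (5 ≤ p ∧ ¬ p ∣ F.disc.natAbs) ∧ p ∣ m, p)
    (hρ : ρ = ∏ p ∈ (Int.gcd q.1 q.2).primeFactors with 5 ≤ p, p) :
    1 ≤ Int.gcd q.1 q.2 ∧ Int.gcd q.1 q.2 ≤ ⌈2 * Y⌉₊ ∧ t ∣ Int.gcd q.1 q.2 ∧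
      Int.gcd q.1 q.2 ≤ 216 * ρ ∧ a ∣ Nat.gcd (Int.gcd q.1 q.2) (radical F.disc.natAbs) ∧
      radical F.disc.natAbs * t ∣ radical (F.disc.natAbs * t) := by
  obtain ⟨hF, -, -, hC, -, hY2, -⟩ := hq
  set g := Int.gcd q.1 q.2 with hg_def
  have hg0 : 0 < g := Int.gcd_pos_iff.mpr (by
    by_contra h; push Not at h; apply hF; rw [h.1, h.2]; simp [BinaryCubic.eval])
  have hDn : F.disc.natAbs ≠ 0 := Int.natAbs_ne_zero.mpr hD
  set q₀ : ℤ × ℤ := (q.1 / (g : ℤ), q.2 / (g : ℤ)) with hq₀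
  have e : ((g : ℤ) * q₀.1, (g : ℤ) * q₀.2) = q := by rw [hq₀]; exact smul_ediv_gcd q
  have hM : Mplus F q = g ^ 6 * Mplus F q₀ := by rw [← mplus_smul, e]
  have hF₀ : Mplus F q₀ ≠ 0 := by
    intro h; rw [h, mul_zero] at hM
    have : F.disc * F.eval q.1 q.2 ^ 2 = 0 := Int.natAbs_eq_zero.mp (Nat.eq_zero_of_le_zero
      (hM ▸ le_max_left _ _))
    exact hF (pow_eq_zero_iff two_ne_zero |>.mp ((mul_eq_zero.mp this).resolve_left hD))
  refine ⟨hg0, ?_, ht ▸ prod_primeFactors_filter_dvd fun p hp _ => Nat.dvd_of_mem_primeFactors hp,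
    hρ ▸ le_mul_rough hg0.ne' hC.1 hC.2.1 hC.2.2, ?_, radical_mul_forced_dvd hDn ht⟩
  · have h1 : g ≤ g ^ 6 * Mplus F q₀ :=
      (Nat.le_self_pow (by norm_num) g).trans (Nat.le_mul_of_pos_right _ (Nat.pos_of_ne_zero hF₀))
    rw [← hM] at h1
    have h2 : (g : ℝ) ≤ ⌈2 * Y⌉₊ := ((Nat.cast_le.mpr h1).trans hY2.le).trans (Nat.le_ceil _)
    exact_mod_cast h2
  · exact ha ▸ Nat.dvd_gcd (prod_primeFactors_filter_dvd fun p hp _ => Nat.dvd_of_mem_primeFactors hp)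
      (prod_primeFactors_filter_dvd fun p hp hP => dvd_radical_of_prime
        (Nat.prime_of_mem_primeFactors hp) hP.2 hDn)

/-! ## 4. The per-key bound and the two elementary sums -/

/-- **Per-key bound.** Kane's bound at the parameters of the key `(g, t)`, simplified to
`C (486XY⁵)^δ · 279937 · X Y^{-1/6} · gcd(g, rad D)/(g · rad D)` (uses `g ≤ 216·rough g`,
`roughIn ≤ gcd(g, rad D)`, `rad D · t ≤ rad(D t)`, `(Y/g⁶)^{-1/6} = g Y^{-1/6}`). -/
theorem key_bound {X Y δ C : ℝ} (hX : 1 ≤ X) (hY : 1 ≤ Y) (hδ : 0 ≤ δ) (hC : 0 ≤ C)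
    {g t a ρ R Rt G N Dn : ℕ} (hg : 1 ≤ g) (hgN : g ≤ N) (hN : (N : ℝ) ≤ 3 * Y)
    (hDn : (Dn : ℝ) ≤ 3 * Y) (ht : 1 ≤ t) (htg : t ≤ g) (hag : a ≤ g) (hρ : 1 ≤ ρ)
    (hgρ : g ≤ 216 * ρ) (haG : a ≤ G) (hG : 1 ≤ G) (hR : 1 ≤ R) (hRt : R * t ≤ Rt) :
    C * ((Dn : ℝ) * (Y / (g : ℝ) ^ 6) * (6 * a * t * X / (ρ : ℝ) ^ 2) * t) ^ δ *
        (6 * a * t * X / (ρ : ℝ) ^ 2 * (Y / (g : ℝ) ^ 6) ^ (-(1 / 6 : ℝ)) / Rt +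
          X * Y ^ (-(1 / 6 : ℝ)) / (g * R))
      ≤ C * (486 * X * Y ^ 5) ^ δ * (279937 * (X * Y ^ (-(1 / 6 : ℝ))) * G / (g * R)) := by
  have hY0 : 0 < Y := by linarith
  have hg0 : (0 : ℝ) < g := by exact_mod_cast hg
  have hρ0 : (0 : ℝ) < ρ := by exact_mod_cast hρ
  have hR0 : (0 : ℝ) < R := by exact_mod_cast hR
  have hRt0 : (0 : ℝ) < Rt := by
    have : (1 : ℝ) ≤ R * t := by exact_mod_cast Nat.mul_le_mul hR ht
    have h' : ((R * t : ℕ) : ℝ) ≤ Rt := by exact_mod_cast hRt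
    push_cast at h'; linarith
  set Q : ℝ := X * Y ^ (-(1 / 6 : ℝ)) with hQ
  have hQ0 : 0 < Q := by positivity
  have hbase : (Dn : ℝ) * (Y / (g : ℝ) ^ 6) * (6 * a * t * X / (ρ : ℝ) ^ 2) * t ≤ 486 * X * Y ^ 5 := by
    have h1 : Y / (g : ℝ) ^ 6 ≤ Y := div_le_self hY0.le (one_le_pow₀ (by exact_mod_cast hg))
    have h2 : 6 * a * t * X / (ρ : ℝ) ^ 2 ≤ 6 * N * N * X := by
      rw [div_le_iff₀ (by positivity)]
      have ha : (a : ℝ) ≤ N := by exact_mod_cast hag.trans hgN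
      have ht' : (t : ℝ) ≤ N := by exact_mod_cast htg.trans hgN
      have hρ1 : (1 : ℝ) ≤ (ρ : ℝ) ^ 2 := one_le_pow₀ (by exact_mod_cast hρ)
      calc 6 * (a : ℝ) * t * X ≤ 6 * N * N * X := by gcongr
        _ = 6 * N * N * X * 1 := (mul_one _).symm
        _ ≤ 6 * N * N * X * (ρ : ℝ) ^ 2 := by gcongr
    have h3 : (t : ℝ) ≤ N := by exact_mod_cast htg.trans hgN
    calc (Dn : ℝ) * (Y / (g : ℝ) ^ 6) * (6 * a * t * X / (ρ : ℝ) ^ 2) * t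
        ≤ (3 * Y) * Y * (6 * N * N * X) * N := by gcongr
      _ ≤ (3 * Y) * Y * (6 * (3 * Y) * (3 * Y) * X) * (3 * Y) := by gcongr
      _ = 486 * X * Y ^ 5 := by ring
  have hpow : ((Dn : ℝ) * (Y / (g : ℝ) ^ 6) * (6 * a * t * X / (ρ : ℝ) ^ 2) * t) ^ δ ≤
      (486 * X * Y ^ 5) ^ δ := Real.rpow_le_rpow (by positivity) hbase hδ
  have hnat : 6 * a * t * g * (g * R) ≤ 279936 * G * (ρ ^ 2 * Rt) := by
    have : g * g ≤ (216 * ρ) * (216 * ρ) := Nat.mul_le_mul hgρ hgρ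
    calc 6 * a * t * g * (g * R) = 6 * (g * g) * (a * (R * t)) := by ring
      _ ≤ 6 * (216 * ρ * (216 * ρ)) * (G * Rt) :=
          Nat.mul_le_mul (Nat.mul_le_mul_left 6 this) (Nat.mul_le_mul haG hRt)
      _ = 279936 * G * (ρ ^ 2 * Rt) := by ring
  have hfirst : 6 * a * t * X / (ρ : ℝ) ^ 2 * (Y / (g : ℝ) ^ 6) ^ (-(1 / 6 : ℝ)) / Rt ≤
      279936 * Q * G / (g * R) := by
    have e : 6 * a * t * X / (ρ : ℝ) ^ 2 * (Y / (g : ℝ) ^ 6) ^ (-(1 / 6 : ℝ)) / Rt =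
        Q * (6 * a * t * g) / ((ρ : ℝ) ^ 2 * Rt) := by
      rw [level_rpow hY0 hg0, hQ]; field_simp
    rw [e, div_le_div_iff₀ (by positivity) (by positivity)]
    have h' : ((6 * a * t * g * (g * R) : ℕ) : ℝ) ≤ ((279936 * G * (ρ ^ 2 * Rt) : ℕ) : ℝ) := by
      exact_mod_cast hnat
    push_cast at h'
    calc Q * (6 * a * t * g) * (g * R) = Q * (6 * a * t * g * (g * R)) := by ring
      _ ≤ Q * (279936 * G * ((ρ : ℝ) ^ 2 * Rt)) := by gcongr
      _ = 279936 * Q * G * ((ρ : ℝ) ^ 2 * Rt) := by ring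
  have hsecond : Q / (g * R) ≤ Q * G / (g * R) := by
    gcongr; exact le_mul_of_one_le_right hQ0.le (by exact_mod_cast hG)
  have hterms : 6 * a * t * X / (ρ : ℝ) ^ 2 * (Y / (g : ℝ) ^ 6) ^ (-(1 / 6 : ℝ)) / Rt + Q / (g * R) ≤
      279937 * Q * G / (g * R) := by
    calc _ ≤ 279936 * Q * G / (g * R) + Q * G / (g * R) := add_le_add hfirst hsecond
      _ = 279937 * Q * G / (g * R) := by ring
  exact mul_le_mul (mul_le_mul_of_nonneg_left hpow hC) hterms (by positivity) (by positivity)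

/-- `Σ_{g ≤ N} gcd(g, R)/g ≤ τ(R) · H_N` (substitute `g = a·b`, `a = gcd(g,R) ∣ R`). -/
theorem sum_gcd_div_le {R : ℕ} (hR : R ≠ 0) (N : ℕ) :
    ∑ g ∈ Finset.Icc 1 N, ((Nat.gcd g R : ℕ) : ℝ) / g ≤
      R.divisors.card * ∑ b ∈ Finset.Icc 1 N, (1 : ℝ) / b := by
  have hφg : ∀ g, Nat.gcd g R * (g / Nat.gcd g R) = g := fun g =>
    Nat.mul_div_cancel' (Nat.gcd_dvd_left _ _)
  have hinj : Set.InjOn (fun g : ℕ => (Nat.gcd g R, g / Nat.gcd g R)) ↑(Finset.Icc 1 N) :=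
    fun g₁ _ g₂ _ h => by
      simp only [Prod.mk.injEq] at h
      rw [← hφg g₁, ← hφg g₂, h.2, h.1]
  calc ∑ g ∈ Finset.Icc 1 N, ((Nat.gcd g R : ℕ) : ℝ) / g
      = ∑ g ∈ Finset.Icc 1 N, (fun x : ℕ × ℕ => (1 : ℝ) / x.2) (Nat.gcd g R, g / Nat.gcd g R) := by
        refine Finset.sum_congr rfl fun g hg => ?_
        have hg1 : 1 ≤ g := (Finset.mem_Icc.mp hg).1
        have hG : (Nat.gcd g R : ℝ) ≠ 0 := by exact_mod_cast (Nat.gcd_pos_of_pos_left R hg1).ne'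
        have e : (g : ℝ) = Nat.gcd g R * (g / Nat.gcd g R : ℕ) := by exact_mod_cast (hφg g).symm
        simp only []
        rw [e]; field_simp
    _ = ∑ x ∈ (Finset.Icc 1 N).image (fun g : ℕ => (Nat.gcd g R, g / Nat.gcd g R)),
          (1 : ℝ) / x.2 := (Finset.sum_image (f := fun x : ℕ × ℕ => (1 : ℝ) / x.2) hinj).symm
    _ ≤ ∑ x ∈ R.divisors ×ˢ Finset.Icc 1 N, (1 : ℝ) / x.2 := by
        refine Finset.sum_le_sum_of_subset_of_nonneg (fun x hx => ?_) fun _ _ _ => by positivity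
        obtain ⟨g, hg, rfl⟩ := Finset.mem_image.mp hx
        obtain ⟨hg1, hgN⟩ := Finset.mem_Icc.mp hg
        exact Finset.mem_product.mpr ⟨Nat.mem_divisors.mpr ⟨Nat.gcd_dvd_right _ _, hR⟩,
          Finset.mem_Icc.mpr ⟨Nat.div_pos (Nat.le_of_dvd hg1 (Nat.gcd_dvd_left _ _))
            (Nat.gcd_pos_of_pos_left _ hg1), (Nat.div_le_self _ _).trans hgN⟩⟩
    _ = R.divisors.card * ∑ b ∈ Finset.Icc 1 N, (1 : ℝ) / b := by
        simp only [Finset.sum_product, Finset.sum_const, nsmul_eq_mul]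

/-- `H_N ≤ (1 + 1/δ) N^δ` for `N ≥ 1` (harmonic bound `H_N ≤ 1 + log N` and `log x ≤ x - 1`). -/
theorem harmonic_le_rpow {δ : ℝ} (hδ : 0 < δ) {N : ℕ} (hN : 1 ≤ N) :
    ∑ b ∈ Finset.Icc 1 N, (1 : ℝ) / b ≤ (1 + 1 / δ) * (N : ℝ) ^ δ := by
  have h1 : ∑ b ∈ Finset.Icc 1 N, (1 : ℝ) / b = (harmonic N : ℝ) := by
    rw [harmonic_eq_sum_Icc]; push_cast; simp [one_div]
  have hN0 : (0 : ℝ) < N := by exact_mod_cast hN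
  have hNδ : 1 ≤ (N : ℝ) ^ δ := Real.one_le_rpow (by exact_mod_cast hN) hδ.le
  have hlog : Real.log N ≤ ((N : ℝ) ^ δ - 1) / δ := by
    rw [le_div_iff₀ hδ, mul_comm, ← Real.log_rpow hN0]
    exact Real.log_le_sub_one_of_pos (by positivity)
  calc ∑ b ∈ Finset.Icc 1 N, (1 : ℝ) / b = (harmonic N : ℝ) := h1
    _ ≤ 1 + Real.log N := harmonic_le_one_add_log N
    _ ≤ 1 + ((N : ℝ) ^ δ - 1) / δ := by linarith
    _ ≤ (1 + 1 / δ) * (N : ℝ) ^ δ := by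
        rw [add_mul, one_mul, sub_div, one_div_mul_eq_div]
        linarith [show (0 : ℝ) ≤ 1 / δ from by positivity]

end FewDeepSlice

open FewDeepSlice in
/-- **Export of this support file** (registered name): `Σ_{g ≤ N} gcd(g, R)/g ≤ τ(R) · H_N`
(`FewDeepSlice.sum_gcd_div_le`). -/
theorem fewDeepSlices_main : ∀ (R N : ℕ), R ≠ 0 → ∑ g ∈ Finset.Icc 1 N, ((Nat.gcd g R : ℕ) : ℝ) / g ≤ R.divisors.card * ∑ b ∈ Finset.Icc 1 N, (1 : ℝ) / b :=
  fun _ N hR => sum_gcd_div_le hR N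

end Summit.ABC.ABC.Theorems.SharpModerateLaw

end
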